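import Summits.BirchSwinnertonDyer.BirchSwinnertonDyer.Theses.SignedBaseChange
import Summits.BirchSwinnertonDyer.BirchSwinnertonDyer.Theorems.SignedBaseChangeK2RAssembly
import HarnessLib

/-!
# K2R⁗ with its two new route names INLINED — the post-freeze closer of the SBC descent crux is one `exact`

Route-independent `Theorems` file of the cell `bsd-wall`, seat `bsd-wall-sbc-p2` g3 (prover of K2R‴ =
stmt-BirchSwinnertonDyer-20213 `Theses.SignedBaseChange.SignedLowerDescentFromCommonFrame`, route
`route-BirchSwinnertonDyer-SignedBaseChange`), written on the route author's ask (bsd-wall-ss g5, cell STATUS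
2026-08-27T13:35:00Z (1)).

STATE OF THE CRUX. K2R‴ (rev 12/13 text) is not closable verbatim: it binds neither the refereed `μ = 0` fact
`BurungaleCastellaSkinner2025.prop422_greenbergAnyRoot_hasUnitContent_minus` (BCS25 Prop. 4.2.2, `L_p^Gr` half,
guarded v2) nor the claim-tagged preprint binder
`BurungaleSkinnerTianWan2024.props118_27_519_exists_signedTwoVariablePackage_supersingular_PRE` (BSTW Props. 1.18 /
2.7 / 5.19), and its `∃`-package lacks the clause c23 «`γ₁` canonical» (seat sbc-p2 g2, verdict «misstated»,
census K2R-CENSUS-v3/v4 on the item). With those three additions it is the tree theorem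
`SignedBaseChangeK2RAssembly.signedLowerDescent_of_prop422_of_package` (p533062). The route author's freeze-end
package rev 14′ (HOME/bsd-wall-ss/rev14/, β-shape; statements frozen until 2026-08-28T09:11Z) restates the crux as
K2R⁗ `SignedLowerDescentFromTwoVariablePackage` := `thm41 → thm12 → ModularParametrizationSupply →
RealPeriodUnitPlusPeriod → GreenbergSupersingularFrameInput → SignedTwoVariableInputs →
TwistPairGreenbergProductDivisibilityCanonical → ∀ W p, 5 ≤ p → ClassX7 W p → Surj W p → ∀ ε,
KobayashiLowerDivisibility W p ε` (rev14/K2R4.sig), with two NEW route names: the cite-only support item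
`SignedTwoVariableInputs` (rev14/Inputs.sig = the conjunction of the two binders) and the crux K1″
`TwistPairGreenbergProductDivisibilityCanonical` (rev14/K1can.sig = K1′ stmt-20502 with c23 inserted after
`κ₁.IsCyclotomic ∧ κ₂.IsAnticyclotomic`).

THIS FILE proves `signedLowerDescent_of_inputs_of_canonical`: EXACTLY rev14/K2R4.sig with the two new names
replaced by their bodies (rev14/Inputs.sig, rev14/K1can.sig, byte-for-byte); every other name is a live route /
Literature declaration. Hence, once rev 14′ is applied, the closer of K2R⁗ is
`theorem … : Theses.SignedBaseChange.SignedLowerDescentFromTwoVariablePackage := signedLowerDescent_of_inputs_of_canonical`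
(the two route `def`s unfold by `δ`). Proof = planner ss g5's certified reorder glue (rev14/Sketch15.lean
f14ebc85c1490685, `k2r4_of_sbcp2Assembly`: K1″ carries c23 in the middle of the package, p533062 at its end) over
p533062. Nothing is asserted about any curve beyond what p533062 asserts; the two binders stay hypotheses
(audit class `proof.conditional` is expected and honest: one refereed fact by name, one PREPRINT binder).
-/

set_option autoImplicit false

namespace Summit.BirchSwinnertonDyer.BirchSwinnertonDyer.Theorems.SignedBaseChangeK2R4Inlined

open Summit.BirchSwinnertonDyer.BirchSwinnertonDyer.Theses.SignedBaseChange

/-- **K2R⁗ (rev 14′ text `K2R4.sig`, the names `SignedTwoVariableInputs` and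
`TwistPairGreenbergProductDivisibilityCanonical` inlined by their bodies `Inputs.sig` / `K1can.sig`).** From
Kobayashi Thm. 4.1 / Thm. 1.2, modularity and the period-unit fact (route aliases `ModularParametrizationSupply`,
`RealPeriodUnitPlusPeriod`), the BSTW common-frame binder `GreenbergSupersingularFrameInput`, the two by-name inputs
(BCS25 Prop. 4.2.2 `L_p^Gr`-half `μ = 0` ∧ the BSTW two-variable signed package binder, PREPRINT) and the CANONICAL
twist-pair Greenberg product package (K1″: `∃ K, …, γ₁ canonical, ∀ frames` product inclusion with cyclotomic
slack), every globally minimal `W/ℚ` in class X7 with surjective mod-`p` image at a prime `p ≥ 5` satisfies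
`KobayashiLowerDivisibility W p ε` for both signs `ε`. Proof: reorder K1″'s clause «`γ₁` canonical» to the end of
the `∃`-package and apply `SignedBaseChangeK2RAssembly.signedLowerDescent_of_prop422_of_package` (p533062).
[cite: BurungaleSkinnerTianWan2024, Part III §2.3 proof of Thm. (KoMC_r) with Props. 1.18, 2.7, 5.19 (arXiv:2409.01350v2; the printed chain this assembles, PREPRINT)]
[cite: BurungaleCastellaSkinner2025, Prop. 4.2.2 (§4.2, p. 9 of arXiv:2405.00270v2; the μ = 0 input, by name)]
[cite: Kobayashi2003, Thm. 4.1 and Thm. 1.2 (the one-variable signed inputs, by name)] -/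
theorem signedLowerDescent_of_inputs_of_canonical :
    Literature.NumberTheory.EllipticCurves.Kobayashi2003.thm41_signedCharIdeal_divisibility →
      Literature.NumberTheory.EllipticCurves.Kobayashi2003.thm12_signedSelmerDual_finite_torsion →
      ModularParametrizationSupply → RealPeriodUnitPlusPeriod → GreenbergSupersingularFrameInput →
      (Literature.NumberTheory.EllipticCurves.BurungaleCastellaSkinner2025.prop422_greenbergAnyRoot_hasUnitContent_minus
      ∧
      Literature.NumberTheory.EllipticCurves.BurungaleSkinnerTianWan2024.props118_27_519_exists_signedTwoVariablePackage_supersingular_PRE)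
      → (Literature.NumberTheory.EllipticCurves.ModularForms.nonempty_modularParametrizationData → ∀ (W :
      WeierstrassCurve ℚ) [W.IsElliptic] [W.IsGloballyMinimal] (p : ℕ) [Fact p.Prime], 5 ≤ p →
      Literature.NumberTheory.EllipticCurves.Rank1Residual.ClassX7 W p →
      Literature.NumberTheory.EllipticCurves.Rank1Residual.Surj W p → ∃ (K : Type) (_ : Field K) (_ :
      NumberField K) (ι : PadicAlgCl p ≃+* ℂ) (v vbar : IsDedekindDomain.HeightOneSpectrum
      (NumberField.RingOfIntegers K)) (κ₁ κ₂ : Literature.NumberTheory.EllipticCurves.ZpExtension K p) (γ₁ γ₂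
      : Field.absoluteGaloisGroup K) (_ : Fact
      (Literature.NumberTheory.EllipticCurves.ZpExtension.IsTopGeneratorPair κ₁ κ₂ γ₁ γ₂)) (_ : NeZero
      (NumberField.discr K).natAbs) (N : ℕ) (_ : NeZero N) (f : CuspForm (CongruenceSubgroup.Gamma0 N) 2) (d
      : ℤ) (W' : WeierstrassCurve ℚ) (_ : W'.IsElliptic) (_ : W'.IsGloballyMinimal) (C :
      WeierstrassCurve.VariableChange ℚ) (N' : ℕ) (_ : NeZero N') (f' : CuspForm (CongruenceSubgroup.Gamma0
      N') 2), Literature.NumberTheory.EllipticCurves.ModularForms.IsNewformOf W f ∧ (N : ℤ) = W.conductorNorm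
      ℤ ∧ Literature.NumberTheory.EllipticCurves.ModularForms.IsNewformOf W' f' ∧ (N' : ℤ) = W'.conductorNorm
      ℤ ∧ Squarefree d ∧ 1 < d ∧ (∀ q : ℕ, q.Prime →
      Literature.NumberTheory.EllipticCurves.BurungaleSkinnerTianWan2024.RamifiedInQuadratic d q → q ≠ p ∧ ¬
      q ∣ N ∧ ¬ (q : ℤ) ∣ NumberField.discr K) ∧ C • W' = W.quadraticTwist (d : ℚ) ∧
      Literature.NumberTheory.EllipticCurves.IsImaginaryQuadratic K ∧ ((Ideal.span {(p : ℤ)}).primesOver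
      (NumberField.RingOfIntegers K)).ncard = 2 ∧ ((p : ℕ) : NumberField.RingOfIntegers K) ∈ v.asIdeal ∧ ((p
      : ℕ) : NumberField.RingOfIntegers K) ∈ vbar.asIdeal ∧ vbar ≠ v ∧ (∀ (w : NumberField.InfinitePlace K)
      (k : NumberField.RingOfIntegers K), k ∈ v.asIdeal ↔ ‖ι.symm (w.embedding (k : K))‖ < 1) ∧ IsCoprime (N
      : ℤ) (NumberField.discr K) ∧ (∀ ℓ : ℕ, ℓ.Prime → ℓ ∣ N → ((Ideal.span {(ℓ : ℤ)}).primesOver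
      (NumberField.RingOfIntegers K)).ncard = 2) ∧ (∀ ℓ : ℕ, ℓ.Prime → (ℓ : ℤ) ∣ d → ((Ideal.span {(ℓ :
      ℤ)}).primesOver (NumberField.RingOfIntegers K)).ncard = 2) ∧ ((Ideal.span {(2 : ℤ)}).primesOver
      (NumberField.RingOfIntegers K)).ncard = 2 ∧ (∀ ρ :
      Literature.NumberTheory.GaloisRepresentations.ModPGaloisRep K (ZMod p) 2, (W.baseChange
      K).IsTorsionGaloisRep p ρ →
      Literature.NumberTheory.GaloisRepresentations.FramedRep.IsAbsolutelyIrreducible ρ) ∧ κ₁.IsCyclotomic ∧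
      κ₂.IsAnticyclotomic ∧ (∃ ζ : ℤ_[p]ˣ, IsOfFinOrder ζ ∧
      ((Literature.NumberTheory.GaloisRepresentations.GaloisRep.cyclotomicCharacter K p γ₁ * ζ : ℤ_[p]ˣ) :
      ℤ_[p]) = (Literature.NumberTheory.EllipticCurves.cyclotomicGenerator p : ℤ_[p])) ∧ ∀ (Ω δ : ℂ) (Ωp :
      (Literature.NumberTheory.EllipticCurves.unrIntegers p)ˣ) (LK G G' : PowerSeries (PowerSeries
      (PadicComplexInt p))), Ω ≠ 0 → (δ ^ 2 = (NumberField.discr K : ℂ) ∨ δ ^ 2 = -(NumberField.discr K : ℂ))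
      → Literature.NumberTheory.EllipticCurves.IsKatzMeasure₂ ι v vbar ∅ κ₁ κ₂ γ₁⁻¹ γ₂⁻¹ 1 Ω δ ((Ωp :
      Literature.NumberTheory.EllipticCurves.unrIntegers p) : PadicComplex p) LK →
      Literature.NumberTheory.EllipticCurves.IsGreenbergLFunctionAnyRoot₂ ι v vbar κ₁ κ₂ γ₁⁻¹ γ₂⁻¹ f
      (NumberField.discr K).natAbs (NumberField.classNumber K) LK G →
      Literature.NumberTheory.EllipticCurves.IsGreenbergLFunctionAnyRoot₂ ι v vbar κ₁ κ₂ γ₁⁻¹ γ₂⁻¹ f'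
      (NumberField.discr K).natAbs (NumberField.classNumber K) LK G' → ∀ J : ℤ_[p] →+* PadicComplexInt p, (∀
      x : ℤ_[p], ((J x : PadicComplexInt p) : PadicComplex p) = ((x : ℚ_[p]) : PadicComplex p)) → ∃ s :
      PowerSeries (PadicComplexInt p), s ≠ 0 ∧ Ideal.span {PowerSeries.map (PowerSeries.C (R :=
      PadicComplexInt p)) s} * ((WeierstrassCurve.XGr₂.charIdeal (W.baseChange K) p κ₁ κ₂ vbar γ₁ γ₂).map
      (Literature.NumberTheory.EllipticCurves.IwasawaAlgebra₂.toUnr₂ p J) * (WeierstrassCurve.XGr₂.charIdeal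
      (W'.baseChange K) p κ₁ κ₂ vbar γ₁ γ₂).map
      (Literature.NumberTheory.EllipticCurves.IwasawaAlgebra₂.toUnr₂ p J)) ≤ Ideal.span {G * G'}) → ∀ (W :
      WeierstrassCurve ℚ) [W.IsElliptic] [W.IsGloballyMinimal] (p : ℕ) [Fact p.Prime], 5 ≤ p →
      Literature.NumberTheory.EllipticCurves.Rank1Residual.ClassX7 W p →
      Literature.NumberTheory.EllipticCurves.Rank1Residual.Surj W p → ∀ ε : ℤˣ,
      Summit.BirchSwinnertonDyer.Rank1Residual.Supersingular.KobayashiLowerDivisibility W p ε := by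
  intro h41 h12 hmodP h5 hGF hIn h₁ W _ _ p _ hp5 hX hs ε
  obtain ⟨K, iF, iNF, ι, v, vbar, κ₁, κ₂, γ₁, γ₂, iTG, iNZ, N, iN, f, d, W', iE', iM', C, N', iN', f',
    c1, c2, c3, c4, c5, c6, c7, c8, c9, c10, c11, c12, c13, c14, c15, c16, c17, c18, c19, c20, c21, hcan, c22⟩ :=
    h₁ hmodP W p hp5 hX hs
  exact SignedBaseChangeK2RAssembly.signedLowerDescent_of_prop422_of_package hIn.1 hIn.2 h41 h12 hmodP h5 hGF
    W p hp5 hX hs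
    ⟨K, iF, iNF, ι, v, vbar, κ₁, κ₂, γ₁, γ₂, iTG, iNZ, N, iN, f, d, W', iE', iM', C, N', iN', f',
      c1, c2, c3, c4, c5, c6, c7, c8, c9, c10, c11, c12, c13, c14, c15, c16, c17, c18, c19, c20, c21, c22, hcan⟩ ε

/-! ### §2. The rev-14″ shape (planner bsd-wall-ss g6, cell STATUS 2026-08-27T14:07:32Z): K1″ gains the
antecedent `SignedTwoVariableInputs` (its text becomes `Inputs.sig → K1can.sig`; `K2R4.sig` unchanged by name). With
that K1″ inlined, K2R⁗ is again closed by ONE `exact` from the theorem below. -/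

/-- **K2R⁗, rev-14″ inlining** (`SignedTwoVariableInputs` ↦ `Inputs.sig`, `TwistPairGreenbergProductDivisibilityCanonical`
↦ `Inputs.sig → K1can.sig`): same content as `signedLowerDescent_of_inputs_of_canonical`, the K1″ hypothesis being fed
the inputs first. [cite: BurungaleSkinnerTianWan2024, Part III §2.3 proof of Thm. (KoMC_r) with Props. 1.18, 2.7, 5.19 (arXiv:2409.01350v2; PREPRINT)]
[cite: BurungaleCastellaSkinner2025, Prop. 4.2.2 (§4.2, p. 9 of arXiv:2405.00270v2; by name)]
[cite: Kobayashi2003, Thm. 4.1 and Thm. 1.2 (by name)] -/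
theorem signedLowerDescent_of_inputs_of_canonicalOfInputs :
    Literature.NumberTheory.EllipticCurves.Kobayashi2003.thm41_signedCharIdeal_divisibility →
      Literature.NumberTheory.EllipticCurves.Kobayashi2003.thm12_signedSelmerDual_finite_torsion →
      ModularParametrizationSupply → RealPeriodUnitPlusPeriod → GreenbergSupersingularFrameInput →
      (Literature.NumberTheory.EllipticCurves.BurungaleCastellaSkinner2025.prop422_greenbergAnyRoot_hasUnitContent_minus
      ∧
      Literature.NumberTheory.EllipticCurves.BurungaleSkinnerTianWan2024.props118_27_519_exists_signedTwoVariablePackage_supersingular_PRE)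
      →
      ((Literature.NumberTheory.EllipticCurves.BurungaleCastellaSkinner2025.prop422_greenbergAnyRoot_hasUnitContent_minus
      ∧
      Literature.NumberTheory.EllipticCurves.BurungaleSkinnerTianWan2024.props118_27_519_exists_signedTwoVariablePackage_supersingular_PRE)
      → Literature.NumberTheory.EllipticCurves.ModularForms.nonempty_modularParametrizationData → ∀ (W :
      WeierstrassCurve ℚ) [W.IsElliptic] [W.IsGloballyMinimal] (p : ℕ) [Fact p.Prime], 5 ≤ p →
      Literature.NumberTheory.EllipticCurves.Rank1Residual.ClassX7 W p →
      Literature.NumberTheory.EllipticCurves.Rank1Residual.Surj W p → ∃ (K : Type) (_ : Field K) (_ :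
      NumberField K) (ι : PadicAlgCl p ≃+* ℂ) (v vbar : IsDedekindDomain.HeightOneSpectrum
      (NumberField.RingOfIntegers K)) (κ₁ κ₂ : Literature.NumberTheory.EllipticCurves.ZpExtension K p) (γ₁ γ₂
      : Field.absoluteGaloisGroup K) (_ : Fact
      (Literature.NumberTheory.EllipticCurves.ZpExtension.IsTopGeneratorPair κ₁ κ₂ γ₁ γ₂)) (_ : NeZero
      (NumberField.discr K).natAbs) (N : ℕ) (_ : NeZero N) (f : CuspForm (CongruenceSubgroup.Gamma0 N) 2) (d
      : ℤ) (W' : WeierstrassCurve ℚ) (_ : W'.IsElliptic) (_ : W'.IsGloballyMinimal) (C :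
      WeierstrassCurve.VariableChange ℚ) (N' : ℕ) (_ : NeZero N') (f' : CuspForm (CongruenceSubgroup.Gamma0
      N') 2), Literature.NumberTheory.EllipticCurves.ModularForms.IsNewformOf W f ∧ (N : ℤ) = W.conductorNorm
      ℤ ∧ Literature.NumberTheory.EllipticCurves.ModularForms.IsNewformOf W' f' ∧ (N' : ℤ) = W'.conductorNorm
      ℤ ∧ Squarefree d ∧ 1 < d ∧ (∀ q : ℕ, q.Prime →
      Literature.NumberTheory.EllipticCurves.BurungaleSkinnerTianWan2024.RamifiedInQuadratic d q → q ≠ p ∧ ¬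
      q ∣ N ∧ ¬ (q : ℤ) ∣ NumberField.discr K) ∧ C • W' = W.quadraticTwist (d : ℚ) ∧
      Literature.NumberTheory.EllipticCurves.IsImaginaryQuadratic K ∧ ((Ideal.span {(p : ℤ)}).primesOver
      (NumberField.RingOfIntegers K)).ncard = 2 ∧ ((p : ℕ) : NumberField.RingOfIntegers K) ∈ v.asIdeal ∧ ((p
      : ℕ) : NumberField.RingOfIntegers K) ∈ vbar.asIdeal ∧ vbar ≠ v ∧ (∀ (w : NumberField.InfinitePlace K)
      (k : NumberField.RingOfIntegers K), k ∈ v.asIdeal ↔ ‖ι.symm (w.embedding (k : K))‖ < 1) ∧ IsCoprime (N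
      : ℤ) (NumberField.discr K) ∧ (∀ ℓ : ℕ, ℓ.Prime → ℓ ∣ N → ((Ideal.span {(ℓ : ℤ)}).primesOver
      (NumberField.RingOfIntegers K)).ncard = 2) ∧ (∀ ℓ : ℕ, ℓ.Prime → (ℓ : ℤ) ∣ d → ((Ideal.span {(ℓ :
      ℤ)}).primesOver (NumberField.RingOfIntegers K)).ncard = 2) ∧ ((Ideal.span {(2 : ℤ)}).primesOver
      (NumberField.RingOfIntegers K)).ncard = 2 ∧ (∀ ρ :
      Literature.NumberTheory.GaloisRepresentations.ModPGaloisRep K (ZMod p) 2, (W.baseChange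
      K).IsTorsionGaloisRep p ρ →
      Literature.NumberTheory.GaloisRepresentations.FramedRep.IsAbsolutelyIrreducible ρ) ∧ κ₁.IsCyclotomic ∧
      κ₂.IsAnticyclotomic ∧ (∃ ζ : ℤ_[p]ˣ, IsOfFinOrder ζ ∧
      ((Literature.NumberTheory.GaloisRepresentations.GaloisRep.cyclotomicCharacter K p γ₁ * ζ : ℤ_[p]ˣ) :
      ℤ_[p]) = (Literature.NumberTheory.EllipticCurves.cyclotomicGenerator p : ℤ_[p])) ∧ ∀ (Ω δ : ℂ) (Ωp :
      (Literature.NumberTheory.EllipticCurves.unrIntegers p)ˣ) (LK G G' : PowerSeries (PowerSeries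
      (PadicComplexInt p))), Ω ≠ 0 → (δ ^ 2 = (NumberField.discr K : ℂ) ∨ δ ^ 2 = -(NumberField.discr K : ℂ))
      → Literature.NumberTheory.EllipticCurves.IsKatzMeasure₂ ι v vbar ∅ κ₁ κ₂ γ₁⁻¹ γ₂⁻¹ 1 Ω δ ((Ωp :
      Literature.NumberTheory.EllipticCurves.unrIntegers p) : PadicComplex p) LK →
      Literature.NumberTheory.EllipticCurves.IsGreenbergLFunctionAnyRoot₂ ι v vbar κ₁ κ₂ γ₁⁻¹ γ₂⁻¹ f
      (NumberField.discr K).natAbs (NumberField.classNumber K) LK G →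
      Literature.NumberTheory.EllipticCurves.IsGreenbergLFunctionAnyRoot₂ ι v vbar κ₁ κ₂ γ₁⁻¹ γ₂⁻¹ f'
      (NumberField.discr K).natAbs (NumberField.classNumber K) LK G' → ∀ J : ℤ_[p] →+* PadicComplexInt p, (∀
      x : ℤ_[p], ((J x : PadicComplexInt p) : PadicComplex p) = ((x : ℚ_[p]) : PadicComplex p)) → ∃ s :
      PowerSeries (PadicComplexInt p), s ≠ 0 ∧ Ideal.span {PowerSeries.map (PowerSeries.C (R :=
      PadicComplexInt p)) s} * ((WeierstrassCurve.XGr₂.charIdeal (W.baseChange K) p κ₁ κ₂ vbar γ₁ γ₂).map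
      (Literature.NumberTheory.EllipticCurves.IwasawaAlgebra₂.toUnr₂ p J) * (WeierstrassCurve.XGr₂.charIdeal
      (W'.baseChange K) p κ₁ κ₂ vbar γ₁ γ₂).map
      (Literature.NumberTheory.EllipticCurves.IwasawaAlgebra₂.toUnr₂ p J)) ≤ Ideal.span {G * G'}) → ∀ (W :
      WeierstrassCurve ℚ) [W.IsElliptic] [W.IsGloballyMinimal] (p : ℕ) [Fact p.Prime], 5 ≤ p →
      Literature.NumberTheory.EllipticCurves.Rank1Residual.ClassX7 W p →
      Literature.NumberTheory.EllipticCurves.Rank1Residual.Surj W p → ∀ ε : ℤˣ,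
      Summit.BirchSwinnertonDyer.Rank1Residual.Supersingular.KobayashiLowerDivisibility W p ε :=
  fun h41 h12 hmodP h5 hGF hIn h₁ ↦ signedLowerDescent_of_inputs_of_canonical h41 h12 hmodP h5 hGF hIn (h₁ hIn)

end Summit.BirchSwinnertonDyer.BirchSwinnertonDyer.Theorems.SignedBaseChangeK2R4Inlined
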